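import Summits.CriticalPhenomena.SAWScalingLimit.Theorems.SAWDefectDecoherenceObservableToSLERCarvedReductionSqueezeInnerOneSided
import Summits.CriticalPhenomena.SAWScalingLimit.Theorems.SAWDefectDecoherenceObservableToSLERCarvedReductionSqueezeInnerFourPoint
import HarnessLib

/-!
# The boundary trace of the limit bulk on the circle: far arcs in cyclic order and their lift
# (piece (K4d) of stub 5a4″ `stub_carvedReduction_squeezeSolid`)

Piece of stub 5a4″ `stub_carvedReduction_squeezeSolid`
(`TwoPieceAdmRestrictionLimit → MovingCarvingSqueezeP FatAnchoredClassZeroSolid`) of the line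
`bridge-gate-renewal` (r11) of the crux `SAWDefectDecoherence.ObservableToSLER`
(stmt-CriticalPhenomena-14005; twin T-A `stub_carvedReduction_squeezeGeometry` of
stmt-CriticalPhenomena-10472), contract `InnerApproximant`, clause (C2) (the boundary loop of the
inner domain is `η`-close to `D.boundary t - τ` PARAMETER BY PARAMETER).  Abstract setting: `Φ`
continuous on the unit circle (the extension of the uniformizer of the limit bulk), `γ` the
boundary loop of `D - τ`, far parameter intervals `F₊ = [a + s, b - s]`, `F₋ = [b + s, a + 1 - s]`
(`a < b` the marks) whose points are boundary values of `Φ` with ONE circle preimage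
(`…SqueezeInnerOneSided`), two disjoint open sets `B₀ ∋ γ (a + s), γ (a + 1 - s)`,
`B₁ ∋ γ (b ± s)` (balls about the marked points) such that every circle value of `Φ` is in
`B₀ ∪ B₁` or a far value, and circle points `ζ₀`, `ζ₁` (the preimages of the gate points) with
`Φ ζᵢ ∈ Bᵢ` not far values.

* `stub_carvedReduction_boundaryTrace` — THE TRACE: an orientation `σ = ±1`, a base angle `c`
  with `e (σ c) = ζ₀`, and a lift `Θ₀`, continuous and strictly increasing on `F₊` and on `F₋`,
  with `Φ (e (σ Θ₀ t)) = γ t` there, in the order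
  `c < Θ₀ (a+s) < Θ₀ (b-s) < q < Θ₀ (b+s) < Θ₀ (a+1-s) < c + 1` (`e (σ q) = ζ₁`), the near arcs
  being mapped into the near balls: `Φ (e (σ θ)) ∈ B₁` for `θ ∈ [Θ₀ (b-s), Θ₀ (b+s)]`, `∈ B₀`
  for `θ ∈ [c, Θ₀ (a+s)] ∪ [Θ₀ (a+1-s), c+1]`.  Proof: the inverse correspondence
  `ξ = Φ⁻¹ ∘ γ` (continuous at unique-preimage values), the angle chart at `ζ₀` and the
  four-point lemma (`…SqueezeInnerFourPoint`), then a reflection in the negatively oriented case.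

Sources: Ch. Pommerenke, Boundary Behaviour of Conformal Maps (1992), §2.4 (prime ends in
circular order — replaced here by the four-point argument), Thm. 2.6.
-/

noncomputable section
open Set Filter Metric Topology Complex Real Function
open Literature.Probability.RandomPlanarGeometry

namespace Summit.CriticalPhenomena.SAWScalingLimit.Theorems.ObservableToSLER.Squeeze

/-! ### The trace theorem -/

/-- **Registered sub-goal `stub_carvedReduction_boundaryTrace`** (crux item stmt-CriticalPhenomena-14005,
stub 5a4″ `stub_carvedReduction_squeezeSolid`, piece (K4c) THE BOUNDARY TRACE): see the module
docstring — an orientation `σ = ±1`, a base angle `c` (`e (σ c) = ζ₀`) and a lift `Θ₀` of the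
far boundary correspondence `t ↦ Φ⁻¹ (γ t)`, continuous and strictly increasing on the two far
parameter intervals, in the order `c < Θ₀ (a+s) < Θ₀ (b-s) < q < Θ₀ (b+s) < Θ₀ (a+1-s) < c+1`
(`e (σ q) = ζ₁`), the near arcs being mapped into the near balls. [cite: PommerenkeBBCM1992, §2.4 (circular order of accessible boundary points)] -/
theorem stub_carvedReduction_boundaryTrace :
    ∀ (Φ : ℂ → ℂ) (γ : ℝ → ℂ) (a b s : ℝ) (B₀ B₁ : Set ℂ) (ζ₀ ζ₁ : ℂ),
      ContinuousOn Φ (sphere (0 : ℂ) 1) → Continuous γ → 0 < s → a + s < b - s →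
      b + s < a + 1 - s → IsOpen B₀ → IsOpen B₁ → Disjoint B₀ B₁ →
      ‖ζ₀‖ = 1 → ‖ζ₁‖ = 1 → Φ ζ₀ ∈ B₀ → Φ ζ₁ ∈ B₁ →
      Φ ζ₀ ∉ γ '' (Icc (a + s) (b - s) ∪ Icc (b + s) (a + 1 - s)) →
      Φ ζ₁ ∉ γ '' (Icc (a + s) (b - s) ∪ Icc (b + s) (a + 1 - s)) →
      (∀ t ∈ Icc (a + s) (b - s) ∪ Icc (b + s) (a + 1 - s),
        γ t ∈ Φ '' sphere 0 1 ∧ (sphere (0 : ℂ) 1 ∩ Φ ⁻¹' {γ t}).Subsingleton) →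
      InjOn γ (Icc (a + s) (b - s) ∪ Icc (b + s) (a + 1 - s)) →
      γ (a + s) ∈ B₀ → γ (a + 1 - s) ∈ B₀ → γ (b - s) ∈ B₁ → γ (b + s) ∈ B₁ →
      (∀ ζ ∈ sphere (0 : ℂ) 1, Φ ζ ∈ B₀ ∪ B₁ ∨
        ∃ t ∈ Icc (a + s) (b - s) ∪ Icc (b + s) (a + 1 - s), Φ ζ = γ t) →
      ∃ (σ c : ℝ) (Θ₀ : ℝ → ℝ), (σ = 1 ∨ σ = -1) ∧ circleMap 0 1 (2 * π * (σ * c)) = ζ₀ ∧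
        ContinuousOn Θ₀ (Icc (a + s) (b - s)) ∧ ContinuousOn Θ₀ (Icc (b + s) (a + 1 - s)) ∧
        StrictMonoOn Θ₀ (Icc (a + s) (b - s)) ∧ StrictMonoOn Θ₀ (Icc (b + s) (a + 1 - s)) ∧
        (∀ t ∈ Icc (a + s) (b - s) ∪ Icc (b + s) (a + 1 - s),
          Φ (circleMap 0 1 (2 * π * (σ * Θ₀ t))) = γ t) ∧
        c < Θ₀ (a + s) ∧ Θ₀ (a + 1 - s) < c + 1 ∧
        (∃ q, Θ₀ (b - s) < q ∧ q < Θ₀ (b + s) ∧ circleMap 0 1 (2 * π * (σ * q)) = ζ₁) ∧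
        (∀ θ ∈ Icc (Θ₀ (b - s)) (Θ₀ (b + s)), Φ (circleMap 0 1 (2 * π * (σ * θ))) ∈ B₁) ∧
        (∀ θ ∈ Icc c (Θ₀ (a + s)) ∪ Icc (Θ₀ (a + 1 - s)) (c + 1),
          Φ (circleMap 0 1 (2 * π * (σ * θ))) ∈ B₀) := by
  intro Φ γ a b s B₀ B₁ ζ₀ ζ₁ hΦc hγc hs hab hba hB₀ hB₁ hdisj hζ₀ hζ₁ hg₀ hg₁ hζ₀far hζ₁far
    hfar hinj ha0 ha1 hb0 hb1 hcover
  -- notation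
  set e : ℝ → ℂ := fun θ => circleMap 0 1 (2 * π * θ) with he
  set Fp : Set ℝ := Icc (a + s) (b - s) with hFp
  set Fm : Set ℝ := Icc (b + s) (a + 1 - s) with hFm
  have hne : ∀ x, x ∈ B₀ → x ∈ B₁ → False := fun x h0 h1' => disjoint_left.1 hdisj h0 h1'
  have hesph : ∀ θ, e θ ∈ sphere (0 : ℂ) 1 := fun θ =>
    mem_sphere_zero_iff_norm.2 (norm_circleMap_two_pi θ)
  -- the inverse boundary correspondence on the far set
  set ξ : ℝ → ℂ := fun t => invFunOn Φ (sphere (0 : ℂ) 1) (γ t) with hξ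
  have hξmem : ∀ t ∈ Fp ∪ Fm, ξ t ∈ sphere (0 : ℂ) 1 ∧ Φ (ξ t) = γ t := fun t ht =>
    ⟨invFunOn_mem (hfar t ht).1, invFunOn_eq (hfar t ht).1⟩
  have hξcont : ContinuousOn ξ (Fp ∪ Fm) := by
    have h1 : ContinuousOn (invFunOn Φ (sphere (0 : ℂ) 1)) (γ '' (Fp ∪ Fm)) :=
      continuousOn_invFunOn_sphere hΦc (by rintro _ ⟨t, ht, rfl⟩; exact (hfar t ht).1)
        (by rintro _ ⟨t, ht, rfl⟩; exact (hfar t ht).2)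
    exact h1.comp hγc.continuousOn (mapsTo_image _ _)
  have hξne₀ : ∀ t ∈ Fp ∪ Fm, ξ t ≠ ζ₀ := fun t ht h =>
    hζ₀far ⟨t, ht, by rw [← (hξmem t ht).2, h]⟩
  -- the angle chart at `ζ₀` and the raw lift `Θ₁ = Ang ∘ ξ`
  obtain ⟨c, Ang, hc, hAngc, hAng⟩ := exists_angleChart hζ₀
  set Θ₁ : ℝ → ℝ := fun t => Ang (ξ t) with hΘ₁
  have hΘ₁e : ∀ t ∈ Fp ∪ Fm, e (Θ₁ t) = ξ t ∧ Θ₁ t ∈ Ioo c (c + 1) := fun t ht =>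
    hAng (ξ t) (hξmem t ht).1 (hξne₀ t ht)
  have hΘ₁γ : ∀ t ∈ Fp ∪ Fm, Φ (e (Θ₁ t)) = γ t := fun t ht => by
    rw [(hΘ₁e t ht).1, (hξmem t ht).2]
  have hΘ₁cont : ContinuousOn Θ₁ (Fp ∪ Fm) :=
    hAngc.comp hξcont fun t ht => ⟨(hξmem t ht).1, hξne₀ t ht⟩
  have hΘ₁inj : InjOn Θ₁ (Fp ∪ Fm) := by
    intro t ht t' ht' htt
    have h1 : ξ t = ξ t' := by rw [← (hΘ₁e t ht).1, ← (hΘ₁e t' ht').1]; exact congrArg e htt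
    have h2 : γ t = γ t' := by rw [← (hξmem t ht).2, ← (hξmem t' ht').2, h1]
    exact hinj ht ht' h2
  -- the four points
  have has : a + s ∈ Fp ∪ Fm := Or.inl (left_mem_Icc.2 hab.le)
  have hbs : b - s ∈ Fp ∪ Fm := Or.inl (right_mem_Icc.2 hab.le)
  have hbs' : b + s ∈ Fp ∪ Fm := Or.inr (left_mem_Icc.2 hba.le)
  have has' : a + 1 - s ∈ Fp ∪ Fm := Or.inr (right_mem_Icc.2 hba.le)
  set p₁ := Θ₁ (a + s) with hp₁
  set p₂ := Θ₁ (b - s) with hp₂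
  set p₃ := Θ₁ (b + s) with hp₃
  set p₄ := Θ₁ (a + 1 - s) with hp₄
  -- monotone or antitone on each far interval
  have hmonoP := (hΘ₁cont.mono subset_union_left).strictMonoOn_of_injOn_Icc' hab.le
    (hΘ₁inj.mono subset_union_left)
  have hmonoM := (hΘ₁cont.mono subset_union_right).strictMonoOn_of_injOn_Icc' hba.le
    (hΘ₁inj.mono subset_union_right)
  -- images of the far intervals lie in the unordered intervals of the endpoint values
  have himgP : ∀ t ∈ Fp, Θ₁ t ∈ uIcc p₁ p₂ := by
    intro t ht
    rcases hmonoP with h | h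
    · exact mem_uIcc.2 (Or.inl ⟨h.monotoneOn (left_mem_Icc.2 hab.le) ht ht.1,
        h.monotoneOn ht (right_mem_Icc.2 hab.le) ht.2⟩)
    · exact mem_uIcc.2 (Or.inr ⟨h.antitoneOn ht (right_mem_Icc.2 hab.le) ht.2,
        h.antitoneOn (left_mem_Icc.2 hab.le) ht ht.1⟩)
  have himgM : ∀ t ∈ Fm, Θ₁ t ∈ uIcc p₃ p₄ := by
    intro t ht
    rcases hmonoM with h | h
    · exact mem_uIcc.2 (Or.inl ⟨h.monotoneOn (left_mem_Icc.2 hba.le) ht ht.1,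
        h.monotoneOn ht (right_mem_Icc.2 hba.le) ht.2⟩)
    · exact mem_uIcc.2 (Or.inr ⟨h.antitoneOn ht (right_mem_Icc.2 hba.le) ht.2,
        h.antitoneOn (left_mem_Icc.2 hba.le) ht ht.1⟩)
  -- conversely the unordered intervals are covered by the images (intermediate values)
  have hsurjP : uIcc p₁ p₂ ⊆ Θ₁ '' Fp := by
    have := intermediate_value_uIcc (a := a + s) (b := b - s) (f := Θ₁)
      (by rw [uIcc_of_le hab.le]; exact hΘ₁cont.mono subset_union_left)
    rwa [uIcc_of_le hab.le] at this
  have hsurjM : uIcc p₃ p₄ ⊆ Θ₁ '' Fm := by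
    have := intermediate_value_uIcc (a := b + s) (b := a + 1 - s) (f := Θ₁)
      (by rw [uIcc_of_le hba.le]; exact hΘ₁cont.mono subset_union_right)
    rwa [uIcc_of_le hba.le] at this
  -- far angles: a point of the two unordered intervals is `Θ₁ t` for a far `t`
  have hfarθ : ∀ θ ∈ uIcc p₁ p₂ ∪ uIcc p₃ p₄, ∃ t ∈ Fp ∪ Fm, Θ₁ t = θ := by
    rintro θ (hθ | hθ)
    · obtain ⟨t, ht, rfl⟩ := hsurjP hθ; exact ⟨t, Or.inl ht, rfl⟩
    · obtain ⟨t, ht, rfl⟩ := hsurjM hθ; exact ⟨t, Or.inr ht, rfl⟩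
  have hJ : max p₁ p₂ < min p₃ p₄ ∨ max p₃ p₄ < min p₁ p₂ := by
    have hdis : ∀ θ, θ ∈ uIcc p₁ p₂ → θ ∈ uIcc p₃ p₄ → False := by
      intro θ hP hM_
      obtain ⟨t, ht, rfl⟩ := hsurjP hP
      obtain ⟨t', ht', htt⟩ := hsurjM hM_
      have : t' = t := hΘ₁inj (Or.inr ht') (Or.inl ht) htt
      rw [this] at ht'
      linarith [ht.2, ht'.1]
    rcases le_or_gt (min p₁ p₂) (min p₃ p₄) with h | h
    · left
      by_contra hnot
      push Not at hnot
      exact hdis (min p₃ p₄) ⟨h, hnot⟩ ⟨le_rfl, min_le_max⟩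
    · right
      by_contra hnot
      push Not at hnot
      exact hdis (min p₁ p₂) ⟨le_rfl, min_le_max⟩ ⟨h.le, hnot⟩
  -- the composite `f = Φ ∘ e` on `[c, c+1]`
  have hfc : ContinuousOn (fun θ => Φ (e θ)) (Icc c (c + 1)) :=
    hΦc.comp continuous_circleMap_two_pi.continuousOn fun θ _ => hesph θ
  have hec1 : e (c + 1) = e c := by
    simpa using circleMap_two_pi_add_int c 1
  have hZ : ∀ θ ∈ Icc c (c + 1), Φ (e θ) ∉ B₀ ∪ B₁ → θ ∈ uIcc p₁ p₂ ∪ uIcc p₃ p₄ := by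
    intro θ hθ hnot
    rcases hcover (e θ) (hesph θ) with h | ⟨t, ht, hteq⟩
    · exact absurd h hnot
    · -- `e θ = ξ t = e (Θ₁ t)` with `θ ∈ [c, c + 1]`, `Θ₁ t ∈ (c, c + 1)`: the angles agree
      have heq : e θ = e (Θ₁ t) := by
        rw [(hΘ₁e t ht).1]
        exact (hfar t ht).2 ⟨hesph θ, hteq⟩ ⟨(hξmem t ht).1, (hξmem t ht).2⟩
      obtain ⟨n, hn⟩ := circleMap_two_pi_eq_iff.1 heq
      have hI := (hΘ₁e t ht).2
      have hn0 : (n : ℝ) = 0 := by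
        have h1 : (-1 : ℝ) < n := by linarith [hθ.1, hI.2]
        have h2 : (n : ℝ) < 1 := by linarith [hθ.2, hI.1]
        have h1' : -1 < n := by exact_mod_cast h1
        have h2' : n < 1 := by exact_mod_cast h2
        have : n = 0 := by omega
        exact_mod_cast this
      rw [hn0, add_zero] at hn
      rw [hn]
      rcases ht with ht | ht
      · exact Or.inl (himgP t ht)
      · exact Or.inr (himgM t ht)
  -- endpoint values
  have hec : e c = ζ₀ := hc
  have hc0 : Φ (e c) ∈ B₀ := by rw [hec]; exact hg₀
  have hc1 : Φ (e (c + 1)) ∈ B₀ := by rw [hec1, hec]; exact hg₀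
  have h1 : Φ (e p₁) ∈ B₀ := by rw [hp₁, hΘ₁γ _ has]; exact ha0
  have h2 : Φ (e p₂) ∈ B₁ := by rw [hp₂, hΘ₁γ _ hbs]; exact hb0
  have h3 : Φ (e p₃) ∈ B₁ := by rw [hp₃, hΘ₁γ _ hbs']; exact hb1
  have h4 : Φ (e p₄) ∈ B₀ := by rw [hp₄, hΘ₁γ _ has']; exact ha1
  have hI₁ := (hΘ₁e _ has).2
  have hI₂ := (hΘ₁e _ hbs).2
  have hI₃ := (hΘ₁e _ hbs').2
  have hI₄ := (hΘ₁e _ has').2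
  have hord := four_point hfc hB₀ hB₁ hdisj hI₁ hI₂ hI₃ hI₄ hJ hZ hc0 hc1 h1 h4 h2 h3
  -- images of gaps: the whole closed gap goes where its left end goes
  have gapI : ∀ u v : ℝ, c ≤ u → u ≤ v → v ≤ c + 1 →
      (∀ θ ∈ Ioo u v, θ ∉ uIcc p₁ p₂ ∪ uIcc p₃ p₄) → Φ (e u) ∈ B₀ ∪ B₁ → Φ (e v) ∈ B₀ ∪ B₁ →
      (fun θ => Φ (e θ)) '' Icc u v ⊆ B₀ ∨ (fun θ => Φ (e θ)) '' Icc u v ⊆ B₁ := by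
    intro u v hcu huv hvc hfree hu hv
    refine subset_or_subset_of_gap (hfc.mono (Icc_subset_Icc hcu hvc)) hB₀ hB₁ hdisj ?_
    intro θ hθ
    rcases hθ.1.eq_or_lt with rfl | hlt
    · exact hu
    rcases hθ.2.eq_or_lt with rfl | hlt'
    · exact hv
    by_contra hnot
    exact hfree θ ⟨hlt, hlt'⟩ (hZ θ ⟨hcu.trans hθ.1, hθ.2.trans hvc⟩ hnot)
  have gap₀ : ∀ u v : ℝ, c ≤ u → u ≤ v → v ≤ c + 1 →
      (∀ θ ∈ Ioo u v, θ ∉ uIcc p₁ p₂ ∪ uIcc p₃ p₄) → Φ (e u) ∈ B₀ → Φ (e v) ∈ B₀ ∪ B₁ →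
      ∀ θ ∈ Icc u v, Φ (e θ) ∈ B₀ := by
    intro u v hcu huv hvc hfree hu hv θ hθ
    rcases gapI u v hcu huv hvc hfree (Or.inl hu) hv with h | h
    · exact h ⟨θ, hθ, rfl⟩
    · exact (hne _ hu (h ⟨u, left_mem_Icc.2 huv, rfl⟩)).elim
  have gap₀' : ∀ u v : ℝ, c ≤ u → u ≤ v → v ≤ c + 1 →
      (∀ θ ∈ Ioo u v, θ ∉ uIcc p₁ p₂ ∪ uIcc p₃ p₄) → Φ (e u) ∈ B₀ ∪ B₁ → Φ (e v) ∈ B₀ →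
      ∀ θ ∈ Icc u v, Φ (e θ) ∈ B₀ := by
    intro u v hcu huv hvc hfree hu hv θ hθ
    rcases gapI u v hcu huv hvc hfree hu (Or.inl hv) with h | h
    · exact h ⟨θ, hθ, rfl⟩
    · exact (hne _ hv (h ⟨v, right_mem_Icc.2 huv, rfl⟩)).elim
  have gap₁ : ∀ u v : ℝ, c ≤ u → u ≤ v → v ≤ c + 1 →
      (∀ θ ∈ Ioo u v, θ ∉ uIcc p₁ p₂ ∪ uIcc p₃ p₄) → Φ (e u) ∈ B₁ → Φ (e v) ∈ B₀ ∪ B₁ →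
      ∀ θ ∈ Icc u v, Φ (e θ) ∈ B₁ := by
    intro u v hcu huv hvc hfree hu hv θ hθ
    rcases gapI u v hcu huv hvc hfree (Or.inr hu) hv with h | h
    · exact (hne _ (h ⟨u, left_mem_Icc.2 huv, rfl⟩) hu).elim
    · exact h ⟨θ, hθ, rfl⟩
  -- the preimage angle of the second gate point
  have hζ₁₀ : ζ₁ ≠ ζ₀ := by rintro rfl; exact hne _ hg₀ hg₁
  obtain ⟨hq, hqI⟩ := hAng ζ₁ (mem_sphere_zero_iff_norm.2 hζ₁) hζ₁₀
  set q := Ang ζ₁ with hqdef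
  have hqe : e q = ζ₁ := hq
  have hqfar : q ∉ uIcc p₁ p₂ ∪ uIcc p₃ p₄ := by
    intro hmem
    obtain ⟨t, ht, htq⟩ := hfarθ q hmem
    refine hζ₁far ⟨t, ht, ?_⟩
    rw [← (hξmem t ht).2, ← (hΘ₁e t ht).1, htq, hqe]
  have hqB : Φ (e q) ∈ B₁ := by rw [hqe]; exact hg₁
  rcases hord with ⟨h12, h23, h34⟩ | ⟨h43, h32, h21⟩
  · /- case A: the chart is positively oriented -/
    have hfreeL : ∀ θ ∈ Ioo c p₁, θ ∉ uIcc p₁ p₂ ∪ uIcc p₃ p₄ := by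
      rintro θ hθ (h | h)
      · rw [uIcc_of_le h12.le] at h; linarith [h.1, hθ.2]
      · rw [uIcc_of_le h34.le] at h; linarith [h.1, hθ.2]
    have hfreeM : ∀ θ ∈ Ioo p₂ p₃, θ ∉ uIcc p₁ p₂ ∪ uIcc p₃ p₄ := by
      rintro θ hθ (h | h)
      · rw [uIcc_of_le h12.le] at h; linarith [h.2, hθ.1]
      · rw [uIcc_of_le h34.le] at h; linarith [h.1, hθ.2]
    have hfreeR : ∀ θ ∈ Ioo p₄ (c + 1), θ ∉ uIcc p₁ p₂ ∪ uIcc p₃ p₄ := by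
      rintro θ hθ (h | h)
      · rw [uIcc_of_le h12.le] at h; linarith [h.2, hθ.1]
      · rw [uIcc_of_le h34.le] at h; linarith [h.2, hθ.1]
    have hL := gap₀ c p₁ le_rfl hI₁.1.le hI₁.2.le hfreeL hc0 (Or.inl h1)
    have hM := gap₁ p₂ p₃ hI₂.1.le h23.le hI₃.2.le hfreeM h2 (Or.inr h3)
    have hR := gap₀' p₄ (c + 1) hI₄.1.le hI₄.2.le le_rfl hfreeR (Or.inl h4) hc1
    have hq₂ : p₂ < q := by
      by_contra hle
      push Not at hle
      have hq₁ : q < p₁ := by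
        by_contra h'
        push Not at h'
        exact hqfar (Or.inl (by rw [uIcc_of_le h12.le]; exact ⟨h', hle⟩))
      exact hne _ (hL q ⟨hqI.1.le, hq₁.le⟩) hqB
    have hq₃ : q < p₃ := by
      by_contra hle
      push Not at hle
      have hq₄ : p₄ < q := by
        by_contra h'
        push Not at h'
        exact hqfar (Or.inr (by rw [uIcc_of_le h34.le]; exact ⟨hle, h'⟩))
      exact hne _ (hR q ⟨hq₄.le, hqI.2.le⟩) hqB
    refine ⟨1, c, Θ₁, Or.inl rfl, by rw [one_mul]; exact hec, hΘ₁cont.mono subset_union_left,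
      hΘ₁cont.mono subset_union_right, ?_, ?_, fun t ht => by rw [one_mul]; exact hΘ₁γ t ht,
      hI₁.1, hI₄.2, ⟨q, hq₂, hq₃, by rw [one_mul]; exact hq⟩, fun θ hθ => ?_, fun θ hθ => ?_⟩
    · exact hmonoP.resolve_right fun h =>
        (lt_asymm h12) (h (left_mem_Icc.2 hab.le) (right_mem_Icc.2 hab.le) hab)
    · exact hmonoM.resolve_right fun h =>
        (lt_asymm h34) (h (left_mem_Icc.2 hba.le) (right_mem_Icc.2 hba.le) hba)
    · rw [one_mul]; exact hM θ hθ
    · rw [one_mul]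
      rcases hθ with hθ | hθ
      · exact hL θ hθ
      · exact hR θ hθ
  · /- case B: the chart is negatively oriented; reverse it -/
    have hfreeL : ∀ θ ∈ Ioo c p₄, θ ∉ uIcc p₁ p₂ ∪ uIcc p₃ p₄ := by
      rintro θ hθ (h | h)
      · rw [uIcc_of_ge h21.le] at h; linarith [h.1, hθ.2]
      · rw [uIcc_of_ge h43.le] at h; linarith [h.1, hθ.2]
    have hfreeM : ∀ θ ∈ Ioo p₃ p₂, θ ∉ uIcc p₁ p₂ ∪ uIcc p₃ p₄ := by
      rintro θ hθ (h | h)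
      · rw [uIcc_of_ge h21.le] at h; linarith [h.1, hθ.2]
      · rw [uIcc_of_ge h43.le] at h; linarith [h.2, hθ.1]
    have hfreeR : ∀ θ ∈ Ioo p₁ (c + 1), θ ∉ uIcc p₁ p₂ ∪ uIcc p₃ p₄ := by
      rintro θ hθ (h | h)
      · rw [uIcc_of_ge h21.le] at h; linarith [h.2, hθ.1]
      · rw [uIcc_of_ge h43.le] at h; linarith [h.2, hθ.1]
    have hL := gap₀ c p₄ le_rfl hI₄.1.le hI₄.2.le hfreeL hc0 (Or.inl h4)
    have hM := gap₁ p₃ p₂ hI₃.1.le h32.le hI₂.2.le hfreeM h3 (Or.inr h2)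
    have hR := gap₀' p₁ (c + 1) hI₁.1.le hI₁.2.le le_rfl hfreeR (Or.inl h1) hc1
    have hq₃ : p₃ < q := by
      by_contra hle
      push Not at hle
      have hq₄ : q < p₄ := by
        by_contra h'
        push Not at h'
        exact hqfar (Or.inr (by rw [uIcc_of_ge h43.le]; exact ⟨h', hle⟩))
      exact hne _ (hL q ⟨hqI.1.le, hq₄.le⟩) hqB
    have hq₂ : q < p₂ := by
      by_contra hle
      push Not at hle
      have hq₁ : p₁ < q := by
        by_contra h'
        push Not at h'
        exact hqfar (Or.inl (by rw [uIcc_of_ge h21.le]; exact ⟨hle, h'⟩))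
      exact hne _ (hR q ⟨hq₁.le, hqI.2.le⟩) hqB
    have hneg : ∀ θ : ℝ, -1 * -θ = θ := fun θ => by ring
    refine ⟨-1, -(c + 1), fun t => -Θ₁ t, Or.inr rfl, ?_, (hΘ₁cont.mono subset_union_left).neg,
      (hΘ₁cont.mono subset_union_right).neg, ?_, ?_, fun t ht => by rw [hneg]; exact hΘ₁γ t ht,
      by linarith [hI₁.2], by linarith [hI₄.1], ⟨-q, by linarith, by linarith, by rw [hneg]; exact hq⟩,
      fun θ hθ => ?_, fun θ hθ => ?_⟩
    · rw [show (-1 : ℝ) * -(c + 1) = c + 1 by ring]; exact hec1.trans hec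
    · intro x hx y hy hxy
      have hanti := hmonoP.resolve_left fun h =>
        (lt_asymm h21) (h (left_mem_Icc.2 hab.le) (right_mem_Icc.2 hab.le) hab)
      exact neg_lt_neg (hanti hx hy hxy)
    · intro x hx y hy hxy
      have hanti := hmonoM.resolve_left fun h =>
        (lt_asymm h43) (h (left_mem_Icc.2 hba.le) (right_mem_Icc.2 hba.le) hba)
      exact neg_lt_neg (hanti hx hy hxy)
    · rw [show (-1 : ℝ) * θ = -θ by ring]
      exact hM (-θ) ⟨by linarith [hθ.2], by linarith [hθ.1]⟩
    · rw [show (-1 : ℝ) * θ = -θ by ring]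
      rcases hθ with hθ | hθ
      · exact hR (-θ) ⟨by linarith [hθ.2], by linarith [hθ.1]⟩
      · exact hL (-θ) ⟨by linarith [hθ.2], by linarith [hθ.1]⟩

end Summit.CriticalPhenomena.SAWScalingLimit.Theorems.ObservableToSLER.Squeeze

end
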